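import Summits.QuantumFields.GaugeBoot.DiagonalRPTorusHexDiagramsOdd
import Summits.QuantumFields.GaugeBoot.DiagonalRPTorusHexShapeOdd
import Summits.QuantumFields.GaugeBoot.DiagonalRPTorusHexAnnulusValue
import HarnessLib

/-!
# The annulus constant of the bent-hexagon pair on ODD tori (gauge-boot, L3 `d = 3` uniform window, odd leg, brick 6)

HONEST FRAMING (cell `pub-gaugeboot`, page 1 of every file): the venture produces certified bounds
on lattice expectations at stated coupling, gauge group, dimension and torus size; NOT a mass gap,
NOT a continuum limit, NOT a string tension; NOT Yang–Mills-summit-bearing (barriers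
`FixedCouplingUltralocality`, `PerturbativeInvisibility`). This module is bookkeeping for a
structural NEGATIVE result (a coupling window UNIFORM in the torus size for the failure of
closed-half diagonal reflection positivity on `(ℤ/L)^3`, `L` odd); it proves no window.

## Content (torus `(ℤ/L)^3`, `L = 2c + 1`, `c ≥ 15`, base `y` with `δ(y) = c`; centre element and (R1))

With `hexFodd = Re χ(W_{θγ})` (word `thexW` from `y + e₀`) and `hexG = Re χ(W_{γ_y})` (even leg):

* `integral_hexFoddG_plaqProd`, `integral_hexFodd_plaqProd` — moments over sub-families of the
  short annulus are charted word-list integrals;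
* ★ vanishing of every proper sub-diagram (`hasLonely_*_odd` + `wlInt_eq_zero_of_hasLonely`);
* ★★ **`integral_hexFoddG_plaqProd_hexTubeOdd : E[hexFodd · hexG · ∏_{annulus} Re χ(U_q)] = c₁^7 N`**;
* ★★ **`replicaTerm_hexTubeOdd_jet`** — `replicaTerm hexFodd hexG (annulus) z = 2 c₁^7 N z^6 + O(z^7)`:
  the near-pair jet `τ₆ = c₁^7 N > 0` of the odd leg.

Elementary given the bricks; no named fact.
-/

open MeasureTheory Finset Function Filter Asymptotics
open scoped Topology

namespace Summit.QuantumFields.GaugeBoot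

open Literature.MathematicalPhysics.QuantumFieldTheory
open Literature.MathematicalPhysics.QuantumFieldTheory.PlaquetteLowerBound (reTr)

noncomputable section

namespace DiagRPHex

open DiagRPTube DiagRPUnif

variable {L : ℕ} [NeZero L] {N : ℕ} {G : Type*} [Group G] [TopologicalSpace G]
  [IsTopologicalGroup G] [CompactSpace G] [MeasurableSpace G] [BorelSpace G]
  [SecondCountableTopology G] (ρ : G →* Matrix (Fin N) (Fin N) ℂ) (y : Site 3 L)

/-- `hexFodd = Re χ(W_{θγ})` on an odd torus: the mirror-image hexagon word read from `y + e₀`. -/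
def hexFodd (U : GaugeConfig 3 L G) : ℝ := reTr ρ (wordHolonomy U (site y (1, 0, 0)) thexW)

omit [SecondCountableTopology G] in
/-- ★ The mixed moment over a sub-family is a word-list integral (odd leg). -/
theorem integral_hexFoddG_plaqProd {S : List LPlaq} (hS : (S.map (plaq y)).Nodup) :
    ∫ V, hexFodd ρ y V * hexG ρ y V * plaqProd ρ (Pt y S) V ∂Measure.pi (fun _ : Edge 3 L => haarProbability G) =
      wlInt ρ (chartWords y (fWordOdd :: gWord :: wordsOf S)) := by
  unfold wlInt
  refine integral_congr_ae (ae_of_all _ fun V => ?_)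
  rw [chartWords_cons, chartWords_cons, wlProd_cons, wlProd_cons, ← plaqProd_Pt ρ y hS]
  simp only [hexFodd, hexG, fWordOdd, gWord, mul_assoc]

omit [SecondCountableTopology G] in
/-- The `hexFodd` moment over a sub-family is a word-list integral. -/
theorem integral_hexFodd_plaqProd {S : List LPlaq} (hS : (S.map (plaq y)).Nodup) :
    ∫ V, hexFodd ρ y V * plaqProd ρ (Pt y S) V ∂Measure.pi (fun _ : Edge 3 L => haarProbability G) =
      wlInt ρ (chartWords y (fWordOdd :: wordsOf S)) := by
  unfold wlInt
  refine integral_congr_ae (ae_of_all _ fun V => ?_)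
  rw [chartWords_cons, wlProd_cons, ← plaqProd_Pt ρ y hS]
  simp only [hexFodd, fWordOdd]

omit [NeZero L] in
/-- A sublist of the odd annulus charts without repetition (`L > 8`). -/
theorem nodup_map_plaq_odd (hL : 8 < L) {S : List LPlaq} (hS : S.Sublist tubeTodd) :
    (S.map (plaq y)).Nodup := by
  have hnd : tubeTodd.Nodup := by decide +kernel
  refine (hS.nodup hnd).map_on fun p hp p' hp' h => ?_
  exact plaq_injOn y (by omega) (inBox_tubeTodd p (hS.subset hp)) (inBox_tubeTodd p' (hS.subset hp')) h

omit [NeZero L] in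
/-- ★ Every sub-family of the odd annulus is charted by a sublist of `tubeTodd`. -/
theorem exists_sublist_of_subset_hexTubeOdd {B : Finset (Plaquette 3 L)} (hB : B ⊆ hexTubeOdd y) :
    ∃ S : List LPlaq, S.Sublist tubeTodd ∧ B = Pt y S := by
  classical
  refine ⟨tubeTodd.filter fun p => plaq y p ∈ B, List.filter_sublist, ?_⟩
  ext q
  simp only [mem_Pt, List.mem_filter, decide_eq_true_eq]
  constructor
  · intro hq
    obtain ⟨p, hp, rfl⟩ := mem_Pt.1 (hB hq)
    exact ⟨p, ⟨hp, hq⟩, rfl⟩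
  · rintro ⟨p, ⟨-, hp⟩, rfl⟩; exact hp

/-! ## Vanishing of the proper sub-diagrams -/

section Vanishing

variable {ρ y} (hL : 8 < L) (hρ : Continuous ρ) {z₀ : G} {ω : ℂ}
  (hz₀ : ρ z₀ = ω • (1 : Matrix (Fin N) (Fin N) ℂ)) (hω : ω ≠ 1)
include hL hρ hz₀ hω

/-- ★ `E[hexFodd · ∏_{q ∈ B} Re χ(U_q)] = 0` for every sub-family `B` of the odd annulus. -/
theorem integral_hexFodd_plaqProd_eq_zero {B : Finset (Plaquette 3 L)} (hB : B ⊆ hexTubeOdd y) :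
    ∫ V, hexFodd ρ y V * plaqProd ρ B V ∂Measure.pi (fun _ : Edge 3 L => haarProbability G) = 0 := by
  obtain ⟨S, hS, rfl⟩ := exists_sublist_of_subset_hexTubeOdd y hB
  rw [integral_hexFodd_plaqProd ρ y (nodup_map_plaq_odd y hL hS)]
  exact wlInt_eq_zero_of_hasLonely ρ y (B := 4) (by omega) hρ hz₀ hω
    (hasLonely_f_odd S (List.mem_sublists.2 hS))

/-- ★ `E[hexG · ∏_{q ∈ B} Re χ(U_q)] = 0` for every sub-family `B` of the odd annulus. -/
theorem integral_hexG_plaqProd_eq_zero_odd {B : Finset (Plaquette 3 L)} (hB : B ⊆ hexTubeOdd y) :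
    ∫ V, hexG ρ y V * plaqProd ρ B V ∂Measure.pi (fun _ : Edge 3 L => haarProbability G) = 0 := by
  obtain ⟨S, hS, rfl⟩ := exists_sublist_of_subset_hexTubeOdd y hB
  rw [integral_hexG_plaqProd ρ y (nodup_map_plaq_odd y hL hS)]
  exact wlInt_eq_zero_of_hasLonely ρ y (B := 4) (by omega) hρ hz₀ hω
    (hasLonely_g_odd S (List.mem_sublists.2 hS))

/-- ★ `E[hexFodd · hexG · ∏_{q ∈ B} Re χ(U_q)] = 0` for every PROPER sub-family of the odd annulus. -/
theorem integral_hexFoddG_plaqProd_eq_zero {B : Finset (Plaquette 3 L)} (hB : B ⊆ hexTubeOdd y)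
    (hne : B ≠ hexTubeOdd y) :
    ∫ V, hexFodd ρ y V * hexG ρ y V * plaqProd ρ B V ∂Measure.pi (fun _ : Edge 3 L => haarProbability G) = 0 := by
  obtain ⟨S, hS, rfl⟩ := exists_sublist_of_subset_hexTubeOdd y hB
  rw [integral_hexFoddG_plaqProd ρ y (nodup_map_plaq_odd y hL hS)]
  refine wlInt_eq_zero_of_hasLonely ρ y (B := 4) (by omega) hρ hz₀ hω
    (hasLonely_fg_odd S (List.mem_sublists.2 hS) fun h => hne ?_)
  rw [h]; rfl

end Vanishing

/-! ## The annulus constant and the jet (odd leg) -/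

/-- ★★ **THE SHORT ANNULUS CONSTANT**: `E[hexFodd · hexG · ∏_{annulus} Re χ(U_q)] = c₁^7 · N`. -/
theorem integral_hexFoddG_plaqProd_hexTubeOdd (hL : 8 < L) (hρ : Continuous ρ) {c₁ : ℝ}
    (hR1 : ∀ x z : G, ∫ g, reTr ρ (x * g⁻¹) * reTr ρ (g * z) ∂haarProbability G = c₁ * reTr ρ (x * z)) :
    ∫ V, hexFodd ρ y V * hexG ρ y V * plaqProd ρ (hexTubeOdd y) V ∂Measure.pi (fun _ : Edge 3 L => haarProbability G) =
      c₁ ^ 7 * N := by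
  have h := integral_hexFoddG_plaqProd ρ y (nodup_map_plaq_odd y hL (List.Sublist.refl tubeTodd))
  rw [hexTubeOdd, h, wlInt_eq_of_runOps ρ y (B := 4) (by omega) hρ hR1 _ _ runOps_annulusOdd, pow_one]

/-- ★ The jet coefficient of the short annulus: `2 c₁^7 N`. -/
theorem jetCoeff_hexTubeOdd (hL : 8 < L) (hρ : Continuous ρ) {z₀ : G} {ω : ℂ}
    (hz₀ : ρ z₀ = ω • (1 : Matrix (Fin N) (Fin N) ℂ)) (hω : ω ≠ 1) {c₁ : ℝ}
    (hR1 : ∀ x z : G, ∫ g, reTr ρ (x * g⁻¹) * reTr ρ (g * z) ∂haarProbability G = c₁ * reTr ρ (x * z)) :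
    jetCoeff ρ (hexFodd ρ y) (hexG ρ y) (hexTubeOdd y) = 2 * (c₁ ^ 7 * N) := by
  rw [← integral_hexFoddG_plaqProd_hexTubeOdd ρ y hL hρ hR1]
  exact jetCoeff_eq_two_mul ρ hρ (continuous_reTr_wordHolonomy ρ hρ _ _).measurable
    (continuous_reTr_wordHolonomy ρ hρ _ _).measurable (abs_reTr_wordHolonomy_le ρ hρ _ _)
    (abs_reTr_wordHolonomy_le ρ hρ _ _) (hexTubeOdd y)
    (fun B hB => integral_hexFodd_plaqProd_eq_zero hL hρ hz₀ hω hB)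
    (fun B hB => integral_hexG_plaqProd_eq_zero_odd hL hρ hz₀ hω hB)
    (fun B hB hne => integral_hexFoddG_plaqProd_eq_zero hL hρ hz₀ hω hB hne)

/-- ★★ **THE JET OF THE SHORT ANNULUS TERM**:
`replicaTerm hexFodd hexG (annulus) z - 2 c₁^7 N z^6 = O(z^7)` at `z = 0`. -/
theorem replicaTerm_hexTubeOdd_jet (hL : 8 < L) (hρ : Continuous ρ) {z₀ : G} {ω : ℂ}
    (hz₀ : ρ z₀ = ω • (1 : Matrix (Fin N) (Fin N) ℂ)) (hω : ω ≠ 1) {c₁ : ℝ}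
    (hR1 : ∀ x z : G, ∫ g, reTr ρ (x * g⁻¹) * reTr ρ (g * z) ∂haarProbability G = c₁ * reTr ρ (x * z)) :
    (fun z => replicaTerm ρ (hexFodd ρ y) (hexG ρ y) (hexTubeOdd y) z - ((2 * (c₁ ^ 7 * N) : ℝ) : ℂ) * z ^ 6)
      =O[𝓝 (0 : ℂ)] fun z => z ^ 7 := by
  have h := replicaTerm_jet ρ hρ (continuous_reTr_wordHolonomy ρ hρ _ _).measurable
    (continuous_reTr_wordHolonomy ρ hρ _ _).measurable (abs_reTr_wordHolonomy_le ρ hρ _ _)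
    (abs_reTr_wordHolonomy_le ρ hρ _ _) (hexTubeOdd y) (f := hexFodd ρ y) (g := hexG ρ y)
  rw [card_hexTubeOdd (y := y) hL, jetCoeff_hexTubeOdd ρ y hL hρ hz₀ hω hR1] at h
  exact h

end DiagRPHex

end

end Summit.QuantumFields.GaugeBoot
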